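import Summits.AtomisticToContinuum.HydrodynamicLimit.Theses.SuperextensiveClosureCost
import Summits.AtomisticToContinuum.HydrodynamicLimit.Theorems.SuperextensiveClosureCostTransferInequalityTools
import HarnessLib

/-!
# `TransferInequality` (support item stmt-AtomisticToContinuum-9512, route `SuperextensiveClosureCost`):
# the static `L²` transfer budget `LG(S)² ≤ e^{C(N+1)} · G(S)`

The support item `TransferInequality` of the route `SuperextensiveClosureCost` of the sub-problem
`HydrodynamicLimit` (= ex stmt-3924 verbatim; shared with the routes `CornersLogPrice`,
`EulerCharacteristics`, `PesinPricing`, `SinaiSteeringDichotomy`): for continuous profiles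
`a₀, θ₀ > 0`, `u₀` and a reference temperature `θe` with `θ₀(x) < 2θe` for all `x`, there is
`σ₀ > 0` (here `σ₀ = 1/2`) such that for every reduced density `0 < σ < σ₀` there is `C` with
`localGibbsLaw σ a₀ u₀ θ₀ N Φ S ² ≤ e^{C(N+1)} · localGibbsLaw σ 1 0 θe N Φ S` for all `N`, every
hard-sphere flow `Φ` and EVERY set `S` of phase space (outer measure: no measurability needed).

Proof (`TransferBudget.localGibbsMeasure_sq_le_exp_mul`, flow-free since the laws do not depend on
the flow, `localGibbsLaw_eq`). Reduce to measurable `S` by outer regularity (`toMeasurable` for `G`).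
On the hard-sphere domain the canonical densities factor through the one-body ratio,
`ρ_LG = Z_LG⁻¹ Z_G · (∏ᵢ f(zᵢ)/g(zᵢ)) · ρ_G` with `f = a₀ M_{1,u₀,θ₀}`, `g = M_{1,0,θe}`; Cauchy–Schwarz
in `L²(G|_S)` gives `LG(S)² ≤ Z_LG⁻² Z_G (∫ 𝟙_D ∏ᵢ f²/g dz) G(S) ≤ Z_LG⁻² Z_G (∫∫ f²/g)^{N+1} G(S)`
(drop the hard core, Tonelli); the tools file bounds `∫∫ f²/g ≤ K` (Gaussian domination, needs
`θ₀ < 2θe`), `Z_G ≤ 1` and `Z_LG ≥ (a(1 − 4πσ³/3))^{N+1}` (free volume by sequential insertion), so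
`C = K / (a(1 − 4πσ³/3))²` works (`x^{N+1} ≤ e^{x(N+1)}`).

References: C. Kipnis, C. Landim, *Scaling Limits of Interacting Particle Systems* (1999), App. 1 §8;
T. Bodineau, I. Gallagher, L. Saint-Raymond, *From hard sphere dynamics to the Stokes–Fourier
equations: an `L²` analysis of the Boltzmann–Grad limit* (2017), §1 (the `L²(M^{⊗N})` framework);
D. Ruelle, *Statistical Mechanics* (1969), §3.4.
-/

noncomputable section

open MeasureTheory Set Filter Topology
open scoped ENNReal

namespace Summit.AtomisticToContinuum.HydrodynamicLimit.Theorems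

namespace TransferBudget

open Literature.Analysis.FluidPDE Literature.MathematicalPhysics.KineticTheory

variable {a₀ θ₀ : T3 → ℝ} {u₀ : T3 → V3}

/-- **The static `L²` budget (flow-free form).** For continuous profiles `a₀, θ₀ > 0`, `u₀` with
`θ₀ < 2θe` and a reduced density `0 < σ < 1/2` there is `C` such that for every particle number and
EVERY set `S` of phase space,
`localGibbsMeasure σ a₀ u₀ θ₀ N S ² ≤ e^{C(N+1)} · localGibbsMeasure σ 1 0 θe N S`.
Proof: outer regularity reduces to measurable `S`; on the hard-sphere domain the canonical densities
factor as `ρ_LG = Z_LG⁻¹ Z_G · (∏ᵢ f(zᵢ)/g(zᵢ)) · ρ_G`; Cauchy–Schwarz in `L²(G|_S)`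
(`lintegral_sq_le_lintegral_sq_mul_measure_univ`) gives
`LG(S)² ≤ Z_LG⁻² Z_G · (∫ 𝟙_D ∏ᵢ f²/g) · G(S) ≤ Z_LG⁻² Z_G (∫ f²/g)^{N+1} G(S)` (Tonelli, dropping
the hard-core indicator), and `∫ f²/g ≤ K` (`lintegral_sq_div_le`), `Z_G ≤ 1`,
`Z_LG ≥ (a(1 − 4πσ³/3))^{N+1}` (`pow_le_posPartition`) give `C = K/(a(1 − 4πσ³/3))²`.
[cite: KipnisLandim1999, App. 1 §8] -/
theorem localGibbsMeasure_sq_le_exp_mul (ha : Continuous a₀) (hθ : Continuous θ₀)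
    (hu : Continuous u₀) (ha0 : ∀ x, 0 < a₀ x) (hθ0 : ∀ x, 0 < θ₀ x) {θe : ℝ}
    (h2 : ∀ x, θ₀ x < 2 * θe) {σ : ℝ} (hσ0 : 0 < σ) (hσ : σ < 1 / 2) :
    ∃ C : ℝ, ∀ (N : ℕ) (S : Set (Config (N + 1) (Fin 3) T3)),
      localGibbsMeasure σ a₀ u₀ θ₀ N S ^ 2 ≤
        ENNReal.ofReal (Real.exp (C * (N + 1))) *
          localGibbsMeasure σ (fun _ => 1) (fun _ => (0 : V3)) (fun _ => θe) N S := by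
  have ha0' : ∀ x, 0 ≤ a₀ x := fun x => (ha0 x).le
  -- profile bounds, with the attained maximum of `θ₀`
  obtain ⟨A, a, -, ϑ, U, ha_pos, hϑ0, -, hA, haa, -, hϑ, hU⟩ :=
    exists_profile_bounds ha hθ hu ha0 hθ0
  obtain ⟨xM, -, hxM⟩ := isCompact_univ.exists_isMaxOn univ_nonempty hθ.continuousOn
  have hΘ : ∀ x, θ₀ x ≤ θ₀ xM := fun x => (isMaxOn_iff.1 hxM) x (mem_univ x)
  have hlt : θ₀ xM < 2 * θe := h2 xM
  have hθe : 0 < θe := by linarith [hθ0 xM]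
  obtain ⟨K, θ', hK, hθ', hdom⟩ :=
    exists_sq_div_le_localMaxwellian ha0' hA hϑ0 hϑ hΘ hU hθe hlt
  have hI := lintegral_sq_div_le (a₀ := a₀) (θ₀ := θ₀) hu hK hθ' hdom
  -- the constant
  set q : ℝ := 1 - 4 * Real.pi / 3 * σ ^ 3 with hq
  have hq0 : 0 < q := by
    have hσ3 : σ ^ 3 < 1 / 8 := by
      have := pow_lt_pow_left₀ hσ hσ0.le (three_ne_zero)
      norm_num at this
      exact this
    rw [hq]; nlinarith [Real.pi_le_four, pow_pos hσ0 3]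
  set L : ℝ := K / (a * q) ^ 2 with hL
  have hL0 : 0 ≤ L := by positivity
  refine ⟨L, fun N S => ?_⟩
  -- notation
  set ε := hsDiameter σ N with hε
  set f : T3 × V3 → ℝ := localGibbsProfile a₀ u₀ θ₀ with hf
  set g : T3 × V3 → ℝ := localGibbsProfile (fun _ => 1) (fun _ => (0 : V3)) (fun _ => θe) with hg
  set D : Set (Config (N + 1) (Fin 3) T3) := hardSphereDomain (Torus.geometry (Fin 3)) (N + 1) ε
    with hD
  set Zf : ℝ := posPartition a₀ ε (N + 1) with hZf
  set Zg : ℝ := posPartition (fun _ => (1 : ℝ)) ε (N + 1) with hZg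
  have hf0 : ∀ y, 0 ≤ f y := fun y => localGibbsProfile_nonneg ha0' (fun x => (hθ0 x).le) y
  have hgpos : ∀ y, 0 < g y := fun y =>
    mul_pos one_pos (localMaxwellian_pos one_pos hθe _ _)
  have hfm : Measurable f := measurable_localGibbsProfile ha hθ hu
  have hgm : Measurable g := measurable_localGibbsProfile continuous_const continuous_const
    continuous_const
  have hZf_eq : canonicalPartition (Torus.geometry (Fin 3)) ε (N + 1) f = Zf :=
    canonicalPartition_eq_posPartition ha hθ hu ha0' hθ0 _ _
  have hZg_eq : canonicalPartition (Torus.geometry (Fin 3)) ε (N + 1) g = Zg :=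
    canonicalPartition_eq_posPartition continuous_const continuous_const continuous_const
      (fun _ => zero_le_one) (fun _ => hθe) _ _
  have hZg_pos : 0 < Zg := posPartition_pos continuous_const (fun _ => one_pos) hσ.le N
  have hZg_le : Zg ≤ 1 := posPartition_one_le_one ε (N + 1)
  have hZf_ge : (a * q) ^ (N + 1) ≤ Zf := pow_le_posPartition ha ha_pos.le haa hσ0 hσ N
  have haq : 0 < a * q := mul_pos ha_pos hq0
  have hZf_pos : 0 < Zf := (pow_pos haq _).trans_le hZf_ge
  -- densities
  set ρf : Config (N + 1) (Fin 3) T3 → ℝ :=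
    canonicalDensity (Torus.geometry (Fin 3)) ε (N + 1) f with hρf
  set ρg : Config (N + 1) (Fin 3) T3 → ℝ :=
    canonicalDensity (Torus.geometry (Fin 3)) ε (N + 1) g with hρg
  have hLG : localGibbsMeasure σ a₀ u₀ θ₀ N =
      volume.withDensity fun z => ENNReal.ofReal (ρf z) := rfl
  have hG : localGibbsMeasure σ (fun _ => 1) (fun _ => (0 : V3)) (fun _ => θe) N =
      volume.withDensity fun z => ENNReal.ofReal (ρg z) := rfl
  have hρgm : Measurable fun z => ENNReal.ofReal (ρg z) :=
    (measurable_canonicalDensity ε (N + 1) hgm).ennreal_ofReal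
  set w : Config (N + 1) (Fin 3) T3 → ℝ≥0∞ := fun z => ENNReal.ofReal (∏ i, f (z i) / g (z i))
    with hw
  have hwm : Measurable w :=
    (Finset.measurable_prod _ fun i _ =>
      (hfm.comp (measurable_pi_apply i)).div (hgm.comp (measurable_pi_apply i))).ennreal_ofReal
  set φ : T3 × V3 → ℝ := fun y => f y ^ 2 / g y with hφ
  have hφ0 : ∀ y, 0 ≤ φ y := fun y => div_nonneg (sq_nonneg _) (hgpos y).le
  have hφm : Measurable fun y => ENNReal.ofReal (φ y) := ((hfm.pow_const 2).div hgm).ennreal_ofReal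
  set c : ℝ≥0∞ := ENNReal.ofReal (Zf⁻¹ * Zg) with hc
  -- (P1) factorisation of the local Gibbs density through the homogeneous one
  have P1 : ∀ z, ENNReal.ofReal (ρf z) = c * w z * ENNReal.ofReal (ρg z) := by
    intro z
    simp only [hρf, hρg, canonicalDensity, hZf_eq, hZg_eq, hc, hw]
    by_cases hz : z ∈ D
    · rw [indicator_of_mem hz, indicator_of_mem hz, tensorPow, tensorPow,
        ← ENNReal.ofReal_mul (mul_nonneg (inv_nonneg.2 hZf_pos.le) hZg_pos.le),
        ← ENNReal.ofReal_mul (mul_nonneg (mul_nonneg (inv_nonneg.2 hZf_pos.le) hZg_pos.le)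
          (Finset.prod_nonneg fun i _ => div_nonneg (hf0 _) (hgpos _).le))]
      congr 1
      have hprod : (∏ i, g (z i)) ≠ 0 := (Finset.prod_pos fun i _ => hgpos (z i)).ne'
      rw [Finset.prod_div_distrib]
      field_simp
    · rw [indicator_of_notMem hz, indicator_of_notMem hz, mul_zero, mul_zero, ENNReal.ofReal_zero,
        mul_zero]
  -- (P2) the square of the ratio against the homogeneous density, dropping the hard core
  have P2 : ∀ z, w z ^ 2 * ENNReal.ofReal (ρg z) ≤
      ENNReal.ofReal Zg⁻¹ * ∏ i, ENNReal.ofReal (φ (z i)) := by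
    intro z
    simp only [hρg, canonicalDensity, hZg_eq, hw, hφ]
    by_cases hz : z ∈ D
    · rw [indicator_of_mem hz, tensorPow,
        ← ENNReal.ofReal_pow (Finset.prod_nonneg fun i _ => div_nonneg (hf0 _) (hgpos _).le),
        ← ENNReal.ofReal_mul (pow_nonneg
          (Finset.prod_nonneg fun i _ => div_nonneg (hf0 _) (hgpos _).le) _),
        ← ENNReal.ofReal_prod_of_nonneg fun i _ => hφ0 (z i),
        ← ENNReal.ofReal_mul (inv_nonneg.2 hZg_pos.le)]
      refine le_of_eq ?_
      congr 1
      have hprod : (∏ i, g (z i)) ≠ 0 := (Finset.prod_pos fun i _ => hgpos (z i)).ne'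
      simp only [hφ]
      rw [Finset.prod_div_distrib, Finset.prod_div_distrib, Finset.prod_pow]
      field_simp
    · rw [indicator_of_notMem hz, mul_zero, ENNReal.ofReal_zero, mul_zero]
      exact bot_le
  -- reduction to a measurable set
  set T := toMeasurable (localGibbsMeasure σ (fun _ => 1) (fun _ => (0 : V3)) (fun _ => θe) N) S
    with hT
  have hTm : MeasurableSet T := measurableSet_toMeasurable _ _
  have hST : S ⊆ T := subset_toMeasurable _ _
  have hGT : localGibbsMeasure σ (fun _ => 1) (fun _ => (0 : V3)) (fun _ => θe) N T =
      localGibbsMeasure σ (fun _ => 1) (fun _ => (0 : V3)) (fun _ => θe) N S := measure_toMeasurable S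
  suffices hmain : localGibbsMeasure σ a₀ u₀ θ₀ N T ^ 2 ≤
      ENNReal.ofReal (Real.exp (L * (N + 1))) *
        localGibbsMeasure σ (fun _ => 1) (fun _ => (0 : V3)) (fun _ => θe) N T by
    calc localGibbsMeasure σ a₀ u₀ θ₀ N S ^ 2 ≤ localGibbsMeasure σ a₀ u₀ θ₀ N T ^ 2 := by
          gcongr
      _ ≤ _ := hmain
      _ = _ := by rw [hGT]
  -- the local Gibbs mass of `T` as an integral against the homogeneous law
  have hLGT : localGibbsMeasure σ a₀ u₀ θ₀ N T =
      c * ∫⁻ z in T, w z ∂localGibbsMeasure σ (fun _ => 1) (fun _ => (0 : V3)) (fun _ => θe) N := by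
    rw [hLG, withDensity_apply _ hTm]
    simp_rw [P1, mul_assoc]
    rw [lintegral_const_mul' _ _ ENNReal.ofReal_ne_top, hG,
      setLIntegral_withDensity_eq_setLIntegral_mul _ hρgm hwm hTm]
    congr 1
    refine lintegral_congr fun z => ?_
    rw [Pi.mul_apply, mul_comm]
  -- Cauchy–Schwarz in `L²(G|_T)`
  have hCS := lintegral_sq_le_lintegral_sq_mul_measure_univ
    ((localGibbsMeasure σ (fun _ => 1) (fun _ => (0 : V3)) (fun _ => θe) N).restrict T)
    hwm.aemeasurable
  rw [Measure.restrict_apply_univ] at hCS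
  -- the `L²` norm of the ratio
  have hW2 : ∫⁻ z in T, w z ^ 2 ∂localGibbsMeasure σ (fun _ => 1) (fun _ => (0 : V3)) (fun _ => θe) N ≤
      ENNReal.ofReal Zg⁻¹ * ENNReal.ofReal K ^ (N + 1) := by
    calc ∫⁻ z in T, w z ^ 2 ∂localGibbsMeasure σ (fun _ => 1) (fun _ => (0 : V3)) (fun _ => θe) N
        ≤ ∫⁻ z, w z ^ 2 ∂localGibbsMeasure σ (fun _ => 1) (fun _ => (0 : V3)) (fun _ => θe) N :=
          setLIntegral_le_lintegral T _
      _ = ∫⁻ z, ENNReal.ofReal (ρg z) * w z ^ 2 := by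
          rw [hG, lintegral_withDensity_eq_lintegral_mul _ hρgm (hwm.pow_const 2)]
          rfl
      _ ≤ ∫⁻ z, ENNReal.ofReal Zg⁻¹ * ∏ i, ENNReal.ofReal (φ (z i)) :=
          lintegral_mono fun z => by rw [mul_comm]; exact P2 z
      _ = ENNReal.ofReal Zg⁻¹ * ∏ _i : Fin (N + 1), ∫⁻ y, ENNReal.ofReal (φ y) := by
          rw [lintegral_const_mul' _ _ ENNReal.ofReal_ne_top, volume_pi,
            @lintegral_fintype_prod_eq_prod' (Fin (N + 1)) _ (fun _ => T3 × V3) _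
              (fun _ => volume) (fun _ => inferInstance) (fun _ y => ENNReal.ofReal (φ y))
              (fun _ => hφm)]
      _ ≤ ENNReal.ofReal Zg⁻¹ * ENNReal.ofReal K ^ (N + 1) := by
          rw [Finset.prod_const, Finset.card_univ, Fintype.card_fin]
          gcongr
  -- the real-number budget
  have hreal : (Zf⁻¹ * Zg) ^ 2 * (Zg⁻¹ * K ^ (N + 1)) ≤ Real.exp (L * (N + 1)) := by
    have h1 : Zf⁻¹ ≤ ((a * q) ^ (N + 1))⁻¹ := inv_anti₀ (pow_pos haq _) hZf_ge
    calc (Zf⁻¹ * Zg) ^ 2 * (Zg⁻¹ * K ^ (N + 1)) = Zf⁻¹ ^ 2 * Zg * K ^ (N + 1) := by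
          field_simp
      _ ≤ ((a * q) ^ (N + 1))⁻¹ ^ 2 * 1 * K ^ (N + 1) := by gcongr
      _ = L ^ (N + 1) := by
          have haq' : a * q ≠ 0 := haq.ne'
          rw [hL, div_pow]
          field_simp
          ring
      _ ≤ Real.exp (L * (N + 1)) := by
          have := pow_le_exp_mul hL0 (N + 1)
          push_cast at this
          exact this
  -- assembly
  calc localGibbsMeasure σ a₀ u₀ θ₀ N T ^ 2
      = c ^ 2 * (∫⁻ z in T, w z
          ∂localGibbsMeasure σ (fun _ => 1) (fun _ => (0 : V3)) (fun _ => θe) N) ^ 2 := by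
        rw [hLGT, mul_pow]
    _ ≤ c ^ 2 * ((∫⁻ z in T, w z ^ 2
          ∂localGibbsMeasure σ (fun _ => 1) (fun _ => (0 : V3)) (fun _ => θe) N) *
          localGibbsMeasure σ (fun _ => 1) (fun _ => (0 : V3)) (fun _ => θe) N T) := by
        gcongr
    _ ≤ c ^ 2 * ((ENNReal.ofReal Zg⁻¹ * ENNReal.ofReal K ^ (N + 1)) *
          localGibbsMeasure σ (fun _ => 1) (fun _ => (0 : V3)) (fun _ => θe) N T) := by
        gcongr
    _ = ENNReal.ofReal ((Zf⁻¹ * Zg) ^ 2 * (Zg⁻¹ * K ^ (N + 1))) *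
          localGibbsMeasure σ (fun _ => 1) (fun _ => (0 : V3)) (fun _ => θe) N T := by
        rw [hc, ← mul_assoc, ← ENNReal.ofReal_pow (mul_nonneg (inv_nonneg.2 hZf_pos.le) hZg_pos.le),
          ← ENNReal.ofReal_pow hK, ← ENNReal.ofReal_mul (inv_nonneg.2 hZg_pos.le),
          ← ENNReal.ofReal_mul (pow_nonneg (mul_nonneg (inv_nonneg.2 hZf_pos.le) hZg_pos.le) _)]
    _ ≤ ENNReal.ofReal (Real.exp (L * (N + 1))) *
          localGibbsMeasure σ (fun _ => 1) (fun _ => (0 : V3)) (fun _ => θe) N T := by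
        gcongr

end TransferBudget

open Literature.Analysis.FluidPDE Literature.MathematicalPhysics.KineticTheory in
/-- **`TransferInequality` holds** (support item stmt-AtomisticToContinuum-9512 of route
`SuperextensiveClosureCost`, concluded BY NAME; the same term closes the verbatim copies of the
item in the routes `CornersLogPrice`, `EulerCharacteristics`, `PesinPricing`,
`SinaiSteeringDichotomy`): for continuous profiles `a₀, θ₀ > 0`, `u₀` and `θe` with `θ₀ < 2θe`
pointwise, with `σ₀ = 1/2`, for every `0 < σ < σ₀` there is `C` such that for all `N`, every
hard-sphere flow `Φ` and EVERY set `S`,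
`localGibbsLaw σ a₀ u₀ θ₀ N Φ S ² ≤ e^{C(N+1)} · localGibbsLaw σ 1 0 θe N Φ S` — the static `L²`
(Cauchy–Schwarz) transfer budget of the relative-entropy / `L²` method
(`TransferBudget.localGibbsMeasure_sq_le_exp_mul`; the laws do not depend on the flow,
`localGibbsLaw_eq`). [cite: KipnisLandim1999, App. 1 §8] -/
theorem transferInequality_proof :
    Summit.AtomisticToContinuum.HydrodynamicLimit.Theses.SuperextensiveClosureCost.TransferInequality := by
  unfold Summit.AtomisticToContinuum.HydrodynamicLimit.Theses.SuperextensiveClosureCost.TransferInequality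
  intro a₀ θ₀ u₀ ha hθ hu ha0 hθ0 θe h2
  refine ⟨1 / 2, by norm_num, fun σ hσ0 hσ => ?_⟩
  obtain ⟨C, hC⟩ := TransferBudget.localGibbsMeasure_sq_le_exp_mul ha hθ hu ha0 hθ0 h2 hσ0 hσ
  refine ⟨C, fun N Φ S => ?_⟩
  rw [localGibbsLaw_eq, localGibbsLaw_eq]
  exact hC N S

end Summit.AtomisticToContinuum.HydrodynamicLimit.Theorems

end
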